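import Literature.AnabelianGeometry.SemiGraphs.TemperedVerticialNamedFactsProofs
import Literature.AnabelianGeometry.SemiGraphs.TemperedFunctorialitySlimSchemaNegative
import HarnessLib

/-!
# [SemiAnbd] Prop. 3.6 (iv) — the cone node `SemiAnbd:Prop3.6(iv)` DISCHARGED BY NAME (proof-only sibling;
# both typed claim decls hypothesis-free; FACT row F-1700 at its surviving INSTANCE form)

S. Mochizuki, *Semi-graphs of anabelioids*, Publ. RIMS **42** (2006) [SemiAnbd], §3 Prop. 3.6 (iv), kurims
manuscript p. 39 [cite: MochizukiSemiAnbd2006, Prop 3.6(iv) p.39].  Cell `abc-iut`, seat abc-iut-w4-d066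
(gen 11); cone row `SemiAnbd:Prop3.6(iv)` (plan/CONE-BOARD.tsv: CLAIM-NOW, node file
`TemperedVerticial.lean` p406435, DEFINITION FROZEN — untouched here), L3-lead γ46 (2026-08-27T02:13:55Z)
«K4 RE-CLOSE of F-0628/F-1700 at the instance forms … sibling only».  PROOF-ONLY: no definition, no instance,
no new named fact; every theorem below is a term made of LANDED theorems consumed BY NAME.

WHAT THE NODE IS.  The node's two typed claim decls (typer abc-iut-L3-t2, `TemperedVerticial.lean`) are the
binder-free propositions
* `ProfiniteSemiGraph.InducedHomOfMorphism` — "Any morphism of semi-graphs of anabelioids `G' → G` induces a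
  morphism of temperoids `B^temp(G') → B^temp(G)` … if the original morphism is locally open, then this morphism
  of temperoids is relatively temp-slim" (both clauses, quantified over all `G'`, `G` satisfying the PRINTED
  standing hypotheses `Prop36Hypotheses` of Prop. 3.6, all morphisms and all charts);
* `ProfiniteSemiGraph.TemperedPiSlim` — "In particular, the temperoid `B^temp(G)` is temp-slim".

WHAT IS PROVED (nothing new — assembled by name).
* `prop36iv_node_holds : InducedHomOfMorphism ∧ TemperedPiSlim` — the node-level conjunction, from
  abc-iut-L3-t8/t10's `inducedHomOfMorphism_holds` and `temperedPiSlim_holds`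
  (`TemperedVerticialNamedFactsProofs.lean` p411511, over abc-iut-L3-d2's Prop. 3.2 surjectivity half
  `TemperoidHomEqRes_holds` p407989).  ZERO hypotheses: no `Prop`-fact binder, no law, no origin datum.
* `exists_inducedHom_of_hom` — the first fact at an arbitrary morphism and pair of charts (the shape a consumer
  applies); the chart-wise form of the second, `isSlimGroup_chart`, is already landed
  (`TemperedFunctorialityInducesLiteral.lean`) and is not repeated.
* FACT-LIST row **F-1700** `VerticialHomRelativelyTempSlim` (an INTERMEDIATE reduction predicate of the clause-2
  proof, abc-iut-L3-t6 `TemperedFunctorialitySlimProofs.lean`): its bare universal closure is REFUTED in the tree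
  (abc-iut-f-045 `not_forall_verticialHomRelativelyTempSlim`, p451458 — the one-vertex `ℤ₂` witness violates
  verticial slimness, i.e. lies OUTSIDE Prop. 3.6's hypotheses), while its INSTANCE form under the printed
  hypotheses is PROVED (`verticialHomRelativelyTempSlim_holds`); `verticialHomRelativelyTempSlim_dichotomy` records
  both conjuncts in one kernel-checked statement, and `inducedHomOfMorphism_holds` consumes only the instance form —
  so NO closer of this node binds the refuted head (consistent with abc-iut-c312-2's CONE-K4-RECLOSE.tsv v4, which
  lists no `SemiAnbd:Prop3.6(iv)` row).  Row F-0628 `Induces` is the [EtTh] Prop. 2.14 (iii) rigidity predicate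
  (`EtaleTheta/ThetaRigidity.lean`); it shares only its short name with [SemiAnbd]'s `Hom.Induces` (F-1712,
  vocabulary), and the module `Literature.AnabelianGeometry.EtaleTheta.ThetaRigidity` does not lie in this file's
  import closure (51 `Literature` modules; the only `EtaleTheta` one is `CyclotomicEnvelope`), so no closer of this
  node can bind it.

HONEST LABEL: discharged = OUR kernel theorems of OUR typed statements of [SemiAnbd] Prop. 3.6 (iv) (a classical,
undisputed 2006 result); typed ≠ proved-in-print; refuted-closure ≠ refuted-paper; nothing here bears on or takes a
side on [IUTchIII] Cor. 3.12; nothing here says abc is proved or refuted.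
-/

namespace Literature.AnabelianGeometry.SemiGraphs

namespace ProfiniteSemiGraph

universe u

variable {𝒢' 𝒢 : ProfiniteSemiGraph.{u}}

/-- **[SemiAnbd] Prop. 3.6 (iv) — node-level discharge BY NAME**: both typed claim decls of the node hold with no
hypothesis: the induced homomorphism of tempered fundamental groups of a morphism `G' → G` (compatible with the
verticial homomorphisms, relatively temp-slim when `G' → G` is locally open) AND temp-slimness of `B^temp(G)`.
[cite: MochizukiSemiAnbd2006, Prop 3.6(iv) p.39] -/
theorem prop36iv_node_holds : InducedHomOfMorphism.{u} ∧ TemperedPiSlim.{u} :=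
  ⟨inducedHomOfMorphism_holds, temperedPiSlim_holds⟩

/-- **[SemiAnbd] Prop. 3.6 (iv), first two sentences, at a given morphism**: for `G'`, `G` as in Prop. 3.6, a
morphism `F : G' → G` and charts `c'`, `c` of the two tempered fundamental groups, there is a continuous
`φ : π₁^temp(G') → π₁^temp(G)` compatible up to conjugation with the verticial homomorphisms and the given
`Π_{v'} → Π_{F v'}`, relatively temp-slim when `F` is locally open.
[cite: MochizukiSemiAnbd2006, Prop 3.6(iv) p.39] -/
theorem exists_inducedHom_of_hom (h𝒢' : 𝒢'.Prop36Hypotheses) (h𝒢 : 𝒢.Prop36Hypotheses) (F : Hom 𝒢' 𝒢)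
    (c' : TemperedPiChart 𝒢') (c : TemperedPiChart 𝒢) :
    ∃ φ : c'.G →ₜ* c.G,
      (∀ (v' : 𝒢'.graph.Vertex) (ψ' : 𝒢'.Gv v' →ₜ* c'.G) (ψ : 𝒢.Gv (F.base.vertexMap v') →ₜ* c.G),
        IsVerticialHom c' v' ψ' → IsVerticialHom c (F.base.vertexMap v') ψ →
          ∃ g : c.G, ∀ x, φ (ψ' x) = g * ψ (F.hV v' x) * g⁻¹) ∧
      (F.IsLocallyOpen → IsRelativelyTempSlim φ) :=
  inducedHomOfMorphism_holds 𝒢' 𝒢 h𝒢' h𝒢 F c' c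

/-- FACT-LIST row **F-1700** at its SURVIVING INSTANCE FORM (closed statement): under the printed hypotheses of
Prop. 3.6, every vertex `v` of `G` carries a verticial homomorphism `Π_v → π₁^temp(G)` that is relatively temp-slim,
for every chart — abc-iut-L3-t10's `verticialHomRelativelyTempSlim_holds`, by name.
[cite: MochizukiSemiAnbd2006, Prop 3.6(iv) p.39] -/
theorem verticialHomRelativelyTempSlim_instanceForm :
    ∀ (𝒢 : ProfiniteSemiGraph.{u}), 𝒢.Prop36Hypotheses →
      ∀ c : TemperedPiChart 𝒢, VerticialHomRelativelyTempSlim 𝒢 c :=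
  fun _ h𝒢 c => verticialHomRelativelyTempSlim_holds h𝒢 c

/-- FACT-LIST row **F-1700**, both readings in ONE kernel-checked statement (universe `0`, where the refuter
lives): the bare universal closure of `VerticialHomRelativelyTempSlim` is FALSE (abc-iut-f-045's one-vertex `ℤ₂`
witness, `not_forall_verticialHomRelativelyTempSlim`), while the instance form under Prop. 3.6's printed
hypotheses HOLDS — the closers of this node consume only the latter.
[cite: MochizukiSemiAnbd2006, Prop 3.6(iv) p.39] -/
theorem verticialHomRelativelyTempSlim_dichotomy :
    (¬ ∀ (𝒢 : ProfiniteSemiGraph.{0}) (c : TemperedPiChart 𝒢), VerticialHomRelativelyTempSlim 𝒢 c) ∧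
      ∀ (𝒢 : ProfiniteSemiGraph.{0}), 𝒢.Prop36Hypotheses →
        ∀ c : TemperedPiChart 𝒢, VerticialHomRelativelyTempSlim 𝒢 c :=
  ⟨not_forall_verticialHomRelativelyTempSlim, fun _ h𝒢 c => verticialHomRelativelyTempSlim_holds h𝒢 c⟩

end ProfiniteSemiGraph

end Literature.AnabelianGeometry.SemiGraphs
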